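import Summits.Ventures.PercRepro.MSTwinProduct
import Summits.Ventures.PercRepro.MSTightPartner

/-!
# Lemma B of Theorem S: the dichotomy at an element with a nonempty partner family

For a tight family `F` and an element `r` with nonempty partner family `K = partner r F`,
`MSTightPartner.lean` sandwiches every member of the larger half between two members of `K`
(`exists_sandwich_of_mem_partr` and, dually, Lemma 3 on the tight `r`-half). The member is
twin-closed for `K` — it differs from a member of `K` by a difference of `K` (`(C1)` / `(C2)`) —
so the convexity of `K` on twin-closed sets (`mem_of_subset_of_subset_of_twinClosed`, granted the
class dichotomy of `K`, the induction hypothesis of Theorem S) puts it into `K`: the larger half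
contains the smaller one. Hence **`F` is closed under adding `r` or under removing `r`**
(`addable_or_deletable_of_partner_nonempty`), and for a twin-free `r` this is the class
dichotomy at `r` (`closedAdd_or_closedRem_of_twinFree`). Paper: Lemma B of
proofs/MINE1-theoremS.md (steps B2–B4).
-/

namespace PercRepro.MSTight

open Finset
open scoped FinsetFamily

variable {α : Type*} [DecidableEq α] [Fintype α]

/-- **Lemma B, first half.** If at most as many members contain `r` as avoid it and the partner
family is nonempty with the class dichotomy, every member containing `r` has its `r`-deletion in
`F`. -/
theorem erase_mem_of_card_le {F : Finset (Finset α)} (hF : Tight F) {r : α}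
    (hK : (partner r F).Nonempty) (h : (partr r F).card ≤ (part0 r F).card)
    (hdich : Dichotomy (partner r F)) : ∀ A ∈ F, r ∈ A → A.erase r ∈ F := by
  intro A hA hrA
  have ha : A.erase r ∈ partr r F :=
    mem_partr.2 ⟨notMem_erase r A, by rw [insert_erase hrA]; exact hA⟩
  obtain ⟨E₁, hE₁, E₀, hE₀, hE₁a, haE₀⟩ := exists_sandwich_of_mem_partr hF hK h ha
  have hKt : Tight (partner r F) := (tight_proj_and_partner (r := r) hF).2.1
  have htc : TwinClosed (partner r F) (A.erase r) := by
    have h' : TwinClosed (partner r F) (E₁ ∪ (A.erase r \ E₁)) :=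
      (twinClosed_of_mem hE₁).union
        (twinClosed_of_mem_diffs (sdiff_mem_diffs_partner_of_mem_partr hF ha hE₁))
    rwa [union_sdiff_of_subset hE₁a] at h'
  have := mem_of_subset_of_subset_of_twinClosed hdich hKt hE₁ hE₀ hE₁a haE₀ htc
  exact (mem_part0.1 (mem_inter.1 this).1).1

/-- **Lemma B, second half.** If at least as many members contain `r` as avoid it and the
partner family is nonempty with the class dichotomy, every member avoiding `r` has its
`r`-extension in `F`. -/
theorem insert_mem_of_card_le {F : Finset (Finset α)} (hF : Tight F) {r : α}
    (hK : (partner r F).Nonempty) (h : (part0 r F).card ≤ (partr r F).card)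
    (hdich : Dichotomy (partner r F)) : ∀ A ∈ F, r ∉ A → insert r A ∈ F := by
  intro b hb hrb
  have hb0 : b ∈ part0 r F := mem_part0.2 ⟨hb, hrb⟩
  obtain ⟨E₁, hE₁, hE₁b⟩ := exists_partner_subset_of_mem_part0 hF hK hb0
  obtain ⟨hLt, hDL⟩ := tight_partr_of_card_le hF r h
  have hLne : (partr r F).Nonempty := by
    obtain ⟨E, hE⟩ := hK
    exact ⟨E, (mem_inter.1 hE).2⟩
  have hcond : ∀ s ∈ partr r F, b \ s ∈ partr r F \\ partr r F := by
    intro s hs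
    rw [hDL]
    obtain ⟨_, hsF⟩ := mem_partr.1 hs
    have h1 : b \ insert r s ∈ F \\ F := mem_diffs.2 ⟨b, hb, insert r s, hsF, rfl⟩
    have h2 : b \ insert r s = b \ s := by
      ext x
      simp only [mem_sdiff, mem_insert, not_or]
      constructor
      · rintro ⟨hx, _, hxs⟩
        exact ⟨hx, hxs⟩
      · rintro ⟨hx, hxs⟩
        exact ⟨hx, fun h => hrb (h ▸ hx), hxs⟩
    rw [h2] at h1
    have hr : r ∉ b \ s := fun hx => hrb (mem_sdiff.1 hx).1
    rw [← diffs_filter_notMem, mem_filter]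
    exact ⟨h1, hr⟩
  obtain ⟨t, ht, hbt⟩ := subset_of_diffs_mem (b ∪ (partr r F).biUnion id) (partr r F) b
    (fun E hE => Finset.subset_union_right.trans' (Finset.subset_biUnion_of_mem id hE))
    Finset.subset_union_left hLne hLt hcond
  obtain ⟨E₀, hE₀, htE₀⟩ := exists_subset_partner_of_mem_partr hF hK ht
  have hbE₀ : b ⊆ E₀ := hbt.trans htE₀
  have hKt : Tight (partner r F) := (tight_proj_and_partner (r := r) hF).2.1
  have htc : TwinClosed (partner r F) b := by
    have h' : TwinClosed (partner r F) (E₀ \ (E₀ \ b)) :=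
      (twinClosed_of_mem hE₀).sdiff
        (twinClosed_of_mem_diffs (sdiff_mem_diffs_partner_of_mem_part0 hF hE₀ hb0))
    rwa [Finset.sdiff_sdiff_eq_self hbE₀] at h'
  have := mem_of_subset_of_subset_of_twinClosed hdich hKt hE₁ hE₀ hE₁b hbE₀ htc
  exact (mem_partr.1 (mem_inter.1 this).2).2

/-- **Lemma B.** With a nonempty partner family satisfying the class dichotomy, `F` is closed
under adding `r` or under removing `r`. -/
theorem addable_or_deletable_of_partner_nonempty {F : Finset (Finset α)} (hF : Tight F) {r : α}
    (hK : (partner r F).Nonempty) (hdich : Dichotomy (partner r F)) :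
    (∀ A ∈ F, r ∉ A → insert r A ∈ F) ∨ (∀ A ∈ F, r ∈ A → A.erase r ∈ F) := by
  rcases le_total (part0 r F).card (partr r F).card with h | h
  · exact Or.inl (insert_mem_of_card_le hF hK h hdich)
  · exact Or.inr (erase_mem_of_card_le hF hK h hdich)

/-- The class of a twin-free element is a singleton. -/
theorem cls_eq_singleton {F : Finset (Finset α)} {r : α} (htf : ∀ x, Twin F r x → x = r) :
    cls F r = {r} := by
  ext x
  rw [mem_cls, mem_singleton]
  exact ⟨fun h => htf x h, fun h => h ▸ twin_refl F r⟩

/-- **The class dichotomy at a twin-free element** with a nonempty partner family satisfying the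
class dichotomy. -/
theorem closedAdd_or_closedRem_of_twinFree {F : Finset (Finset α)} (hF : Tight F) {r : α}
    (hK : (partner r F).Nonempty) (hdich : Dichotomy (partner r F))
    (htf : ∀ x, Twin F r x → x = r) : ClosedAdd F (cls F r) ∨ ClosedRem F (cls F r) := by
  rw [cls_eq_singleton htf]
  rcases addable_or_deletable_of_partner_nonempty hF hK hdich with h | h
  · left
    intro t ht
    by_cases hrt : r ∈ t
    · rw [union_eq_left.2 (singleton_subset_iff.2 hrt)]
      exact ht
    · have e : t ∪ {r} = insert r t := by
        ext x
        simp
      rw [e]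
      exact h t ht hrt
  · right
    intro t ht
    rw [sdiff_singleton_eq_erase]
    by_cases hrt : r ∈ t
    · exact h t ht hrt
    · rw [erase_eq_of_notMem hrt]
      exact ht

end PercRepro.MSTight
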